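import Summits.CriticalPhenomena.PercolationContinuityZ3.Theorems.PercNearOneGluingNoHeavyLowerTailGreedyComparatorTools
import HarnessLib

/-!
# `NoHeavyLowerTail` (stmt-CriticalPhenomena-4575) — PIVOT CERTIFICATES for the cumulative isolation lemma

Support file (lemma factory `prim-lf-6`, observer-set technique; `--supports stmt-CriticalPhenomena-4575`).  No definitions, no named facts,
no sorries.  Successor of `…GreedyComparator.lean`: the single-edge/single-designee comparator there (`stub_greedyComparator`, GCC) was REFUTED by
ttrl2's exact census (witness W1: relays `{0,1,2}`, free `{3,4,5}`, weights `0–3: 1/2, 0–5: 3/4, 1–3: 7/8, 2–4: 1/2, 2–5: 1/2, 3–4: 7/8`, `j = 1`,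
`T = {4,5}`; `run/shared/lean/ttrl/lf6/GCC.md`), while the quantity the induction bounds (`A_w(T;i,a) ≥ 0`) held at every failure node and every
failure node was rescued by a more flexible step (separate designees per branch, the contracted convention for the absorbed pair, nested pivots).
This file therefore proves the SOUNDNESS OF PIVOT CERTIFICATES in general and leaves as the single hypothesis the EXISTENCE of a certificate for
every root — the weakest statement this induction can consume.

Notation (`μ_w = prodBernoulli w` on `Fin n`, relays `A`, level `j`, `π`, lightness `I_w`, observer set `T`, events `E₁, E₂, E₃, Q` as in
`…GreedyComparatorTools.lean`): `A_w(T;d,a) := μE₁(T,d) − μE₂(T,d) − μE₃(T,a)` and `q_w(T,d) := μE₁(T,d) + μQ(T,d)` (lightness of `d` with `T`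
contracted).  CST@champion at a free observer `x` is `A_w({x}; a₀, a₀) ≥ 0` for a champion `a₀`; it implies `stub_cumulativeIsolation`.

**Certificate rules** (each is an exact identity or a landed inequality for `Good(w,T,d,β) := "β ≤ A_w(T;d,a₀)"`):
* (mono) `Good(w,T,d,β)` and `β' ≤ β` give `Good(w,T,d,β')`;
* (base) `T` disjoint from `A` and no boundary pair of `T` of positive weight: `Good(w,T,d, I_w(d) − I_w(a₀))` (nothing leaves `T` a.s.);
* (relay leaf) `r ∈ T ∩ A` with `I_w(r) ≤ I_w(d)`: `Good(w,T,d,0)` (van den Berg–Häggström–Kahn observer-set transfer, `observerSet_le_of_lonelier`);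
* (pivot) any pair `e`, relays `d, d₀, d₁`: `Good(w[e↦0],T,d₀,β₀)` and `Good(w[e↦1],T,d₁,β₁)` give `Good(w,T,d,(1−w e)β₀ + (w e)β₁ + comparator)`,
  `comparator = (1−w e)[q_{w[e↦0]}(T,d) − q_{w[e↦0]}(T,d₀)] + (w e)[q_{w[e↦1]}(T,d) − q_{w[e↦1]}(T,d₁)]` (one-bond decomposition + switch identity);
* (absorbing pivot) boundary pair `e = s(y,z)`, `y ∈ T`, `z ∉ T`, convention `c ∈ {0,1}`: `Good(w[e↦0],T,d₀,β₀)` and `Good(w[e↦c],T ∪ {z},d₁,β₁)` give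
  `Good(w,T,d,(1−w e)β₀ + (w e)β₁ + comparator)` — opening `e` is absorbing `z` into the observer set; the absorbed pair is then irrelevant, so the open
  child may be read with `e` at weight `0` OR `1` (the two conventions have different champions downstream; ttrl2's witness W1 needs `c = 1`).
A PIVOT CERTIFICATE for a root `(w, x, a₀)` is a finite derivation of `Good(w,{x},a₀,0)` from these rules; impredicatively, `Good(w,{x},a₀,0)` holds for
EVERY predicate `Good` closed under the rules — the hypothesis `hCert` below.  COMPLETENESS (remark, not formalised): the calculus is EXACT — keeping the
designee on every pivot costs nothing, and on a relay absorption switching to the absorbed relay `z` itself makes the relay leaf exact (`A(T∪{z}; z) = 0`),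
so the optimal certificate value equals `A_w(T;d,a₀)` at every node (checked in exact arithmetic on 245 random roots, `lab/vdp.py`: optimum = `A` every time).
Hence `hCert` is EQUIVALENT to CST@champion (`A_w({x};a₀,a₀) ≥ 0` at every root), and this file is an exact UNFOLDING of that inequality into lightness
comparisons `I(d) − I(a₀)` on terminal graphs plus switch costs — the bookkeeping any comparator strategy needs.  The genuinely STRONGER (refutable)
statements are RESTRICTED strategies: the refuted GCC ("one boundary pair, one champion of `w[e↦0]` for both children"); F1 ("one boundary pair, a champion
of each child, both conventions"; refuted at ttrl2's W3); F2 ("≤ 2 nested boundary pivots, champion designees at the leaves") — alive: 127/127 GCC-failure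
nodes and 1 307/1 307 random roots (`lab/certify2.py`, ttrl2 RESULT 1c/1d); full census requested (`lf6-pivot-family-census`).  A strategy statement that
survives the census is what should be registered as the stub of this line; `hCert` itself should not be (it is the target in certificate clothing).

**Theorems.** `cst_of_pivotCertificate` (soundness: `hCert` gives `A_w({x};a₀,a₀) ≥ 0` at every free observer with champion `a₀`),
`cumulativeIsolation_of_pivotCertificate : hCert → stub_cumulativeIsolation`, `noHeavyLowerTail_of_pivotCertificate : hCert → NoHeavyLowerTail`.
-/

noncomputable section

namespace Summit.CriticalPhenomena.PercolationContinuityZ3.Theorems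

open MeasureTheory Set Literature.Probability.LatticeModels Literature.Probability.Percolation
open scoped Classical BigOperators

variable {n : ℕ}

namespace PivotCertificate

open ChampionStability GreedyComparator

/-! ### The two leaf rules with general designees -/

/-- **Base value.**  If `T` is disjoint from `A` and no boundary pair of `T` has positive weight, then for ANY relays `d, a`:
`A_w(T;d,a) ≥ I_w(d) − I_w(a)` (`μE₂ = 0`, `μE₁ = I(d)`, `μE₃ ≤ I(a)`). [folklore] -/
theorem base_ge (w : Sym2 (Fin n) → unitInterval) (T A : Finset (Fin n)) (hTA : Disjoint T A) {d a : Fin n}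
    (hd : d ∈ A) (j : ℕ) (hbd : ∀ y ∈ T, ∀ z, z ∉ T → (w s(y, z) : ℝ) = 0) :
    (prodBernoulli w).real {ω : BondConfig (Fin n) | (A.filter fun u => ω ∈ openConn d u).card ≤ j} -
        (prodBernoulli w).real {ω : BondConfig (Fin n) | (A.filter fun u => ω ∈ openConn a u).card ≤ j} ≤
      ((prodBernoulli w).real {ω : BondConfig (Fin n) | (∀ t ∈ T, ω ∉ openConn d t) ∧ (A.filter fun u => ω ∈ openConn d u).card ≤ j} -
          (prodBernoulli w).real {ω : BondConfig (Fin n) | (∀ t ∈ T, ω ∉ openConn d t) ∧ 1 ≤ (A.filter fun u => ∃ t ∈ T, ω ∈ openConn t u).card ∧ (A.filter fun u => ∃ t ∈ T, ω ∈ openConn t u).card ≤ j} -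
          (prodBernoulli w).real {ω : BondConfig (Fin n) | (A.filter fun u => ∃ t ∈ T, ω ∈ openConn t u).card = 0 ∧ (A.filter fun u => ω ∈ openConn a u).card ≤ j}) := by
  set F : Finset (Sym2 (Fin n)) :=
    ((Finset.univ : Finset (Fin n × Fin n)).filter fun q => q.1 ∈ T ∧ q.2 ∉ T).image fun q => s(q.1, q.2) with hF
  set Bad : Set (BondConfig (Fin n)) := {ω | ∃ e ∈ F, e ∈ ω} with hBad
  have hmeas : ∀ S : Set (BondConfig (Fin n)), MeasurableSet S := fun S => (Set.toFinite S).measurableSet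
  have hBad0 : (prodBernoulli w).real Bad = 0 := by
    have h0 : prodBernoulli w Bad = 0 := by
      refine prodBernoulli_setOf_exists_mem_eq_zero w F fun e he => ?_
      obtain ⟨q, hq, rfl⟩ := Finset.mem_image.1 he
      obtain ⟨hq1, hq2⟩ := (Finset.mem_filter.1 hq).2
      exact hbd q.1 hq1 q.2 hq2
    rw [measureReal_def, h0, ENNReal.toReal_zero]
  have hcut : ∀ ω : BondConfig (Fin n), ω ∉ Bad → ∀ t ∈ T, ∀ x, x ∉ T → ¬ (openGraph ω).Reachable t x := by
    intro ω hω t ht x hx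
    refine not_reachable_openGraph_of_closed_cut ω (↑T : Set (Fin n)) (Finset.mem_coe.2 ht)
      (fun h => hx (Finset.mem_coe.1 h)) fun u hu v hv huv => hω ?_
    refine ⟨s(u, v), Finset.mem_image.2 ⟨(u, v), Finset.mem_filter.2 ⟨Finset.mem_univ _, Finset.mem_coe.1 hu,
      fun h => hv (Finset.mem_coe.2 h)⟩, rfl⟩, huv⟩
  have hdT : d ∉ T := fun h => Finset.disjoint_left.1 hTA h hd
  have hE2 : (prodBernoulli w).real {ω : BondConfig (Fin n) | (∀ t ∈ T, ω ∉ openConn d t) ∧ 1 ≤ (A.filter fun u => ∃ t ∈ T, ω ∈ openConn t u).card ∧ (A.filter fun u => ∃ t ∈ T, ω ∈ openConn t u).card ≤ j} ≤ 0 := by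
    rw [← hBad0]
    refine measureReal_mono (fun ω hω => ?_) (measure_ne_top _ _)
    obtain ⟨-, h1, -⟩ := hω
    obtain ⟨x, hx⟩ := Finset.card_pos.1 (by omega : 0 < (A.filter fun x => ∃ t ∈ T, ω ∈ openConn t x).card)
    obtain ⟨hxA, t, ht, htx⟩ := Finset.mem_filter.1 hx
    by_contra hω'
    exact hcut ω hω' t ht x (fun h => Finset.disjoint_left.1 hTA h hxA) htx
  have hE1 : (prodBernoulli w).real {ω : BondConfig (Fin n) | (A.filter fun u => ω ∈ openConn d u).card ≤ j} ≤
      (prodBernoulli w).real {ω : BondConfig (Fin n) | (∀ t ∈ T, ω ∉ openConn d t) ∧ (A.filter fun u => ω ∈ openConn d u).card ≤ j} + (prodBernoulli w).real Bad := by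
    calc (prodBernoulli w).real {ω : BondConfig (Fin n) | (A.filter fun u => ω ∈ openConn d u).card ≤ j}
        ≤ (prodBernoulli w).real ({ω : BondConfig (Fin n) | (∀ t ∈ T, ω ∉ openConn d t) ∧ (A.filter fun u => ω ∈ openConn d u).card ≤ j} ∪ Bad) := by
          refine measureReal_mono (fun ω hω => ?_) (measure_ne_top _ _)
          by_cases hb : ω ∈ Bad
          · exact Or.inr hb
          · refine Or.inl ⟨fun t ht hdt => hcut ω hb t ht d hdT ?_, hω⟩
            exact ((mem_openConn_iff_reachable ω d t).1 hdt).symm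
      _ ≤ _ := measureReal_union_le _ _
  have hE3 : (prodBernoulli w).real {ω : BondConfig (Fin n) | (A.filter fun u => ∃ t ∈ T, ω ∈ openConn t u).card = 0 ∧ (A.filter fun u => ω ∈ openConn a u).card ≤ j} ≤
      (prodBernoulli w).real {ω : BondConfig (Fin n) | (A.filter fun u => ω ∈ openConn a u).card ≤ j} :=
    measureReal_mono (fun ω hω => hω.2) (measure_ne_top _ _)
  linarith

/-- **Relay leaf.**  If `r ∈ T ∩ A` is no lighter than the designee `d` (`I(r) ≤ I(d)`), then `A_w(T;d,a) ≥ 0` for every `a`: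
`E₃ = ∅` and `μE₂ ≤ μE₁` is the observer-set transfer.
[cite: VandenbergHaggstromKahn2005, Thm. 1.5 (p. 7) — via Literature.Probability.Percolation.observerSet_le_of_lonelier] -/
theorem relay_leaf_nonneg (w : Sym2 (Fin n) → unitInterval) (T A : Finset (Fin n)) {r d a : Fin n}
    (hrT : r ∈ T) (hrA : r ∈ A) (j : ℕ)
    (hle : (prodBernoulli w).real {ω : BondConfig (Fin n) | (A.filter fun u => ω ∈ openConn r u).card ≤ j} ≤
      (prodBernoulli w).real {ω : BondConfig (Fin n) | (A.filter fun u => ω ∈ openConn d u).card ≤ j}) :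
    0 ≤ ((prodBernoulli w).real {ω : BondConfig (Fin n) | (∀ t ∈ T, ω ∉ openConn d t) ∧ (A.filter fun u => ω ∈ openConn d u).card ≤ j} -
          (prodBernoulli w).real {ω : BondConfig (Fin n) | (∀ t ∈ T, ω ∉ openConn d t) ∧ 1 ≤ (A.filter fun u => ∃ t ∈ T, ω ∈ openConn t u).card ∧ (A.filter fun u => ∃ t ∈ T, ω ∈ openConn t u).card ≤ j} -
          (prodBernoulli w).real {ω : BondConfig (Fin n) | (A.filter fun u => ∃ t ∈ T, ω ∈ openConn t u).card = 0 ∧ (A.filter fun u => ω ∈ openConn a u).card ≤ j}) := by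
  have hE3 : {ω : BondConfig (Fin n) | (A.filter fun u => ∃ t ∈ T, ω ∈ openConn t u).card = 0 ∧ (A.filter fun u => ω ∈ openConn a u).card ≤ j} = ∅ := by
    ext ω
    simp only [mem_setOf_eq, mem_empty_iff_false, iff_false, not_and]
    intro h0
    exfalso
    have hmem : r ∈ A.filter fun x => ∃ t ∈ T, ω ∈ openConn t x :=
      Finset.mem_filter.2 ⟨hrA, r, hrT, (mem_openConn_iff_reachable ω r r).2 (SimpleGraph.Reachable.refl r)⟩
    rw [Finset.card_eq_zero] at h0
    rw [h0] at hmem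
    exact Finset.notMem_empty r hmem
  have hA := observerSet_le_of_lonelier w A T r d hrT j hle
  rw [hE3, measureReal_empty, sub_zero, sub_nonneg]
  convert hA using 7
  all_goals exact congrArg Finset.card (@Finset.filter_congr _ _ _ (_) (_) _ fun _ _ => Iff.rfl)

/-! ### The absorbed pair is irrelevant: `w[e↦1]` and `w[e↦0]` agree on the events of `T ∪ {z}` -/

/-- For `y ∈ T` and `e = s(y,z)`, `y ≠ z`: the events `E₁, E₂, E₃, Q` of the observer set `insert z T` have the same probability under
`w[e↦1]` and `w[e↦0]` (both endpoints of `e` lie in the observer set). [folklore] -/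
theorem real_update_one_eq_zero_of_absorbed (w : Sym2 (Fin n) → unitInterval) (T A : Finset (Fin n)) {y z : Fin n}
    (hyz : y ≠ z) (hy : y ∈ T) (v a : Fin n) (ha : a ∈ A) (j : ℕ) :
    (prodBernoulli (Function.update w s(y, z) 1)).real {ω : BondConfig (Fin n) | (∀ t ∈ (insert z T), ω ∉ openConn v t) ∧ (A.filter fun u => ω ∈ openConn v u).card ≤ j} =
        (prodBernoulli (Function.update w s(y, z) 0)).real {ω : BondConfig (Fin n) | (∀ t ∈ (insert z T), ω ∉ openConn v t) ∧ (A.filter fun u => ω ∈ openConn v u).card ≤ j} ∧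
      (prodBernoulli (Function.update w s(y, z) 1)).real {ω : BondConfig (Fin n) | (∀ t ∈ (insert z T), ω ∉ openConn v t) ∧ 1 ≤ (A.filter fun u => ∃ t ∈ (insert z T), ω ∈ openConn t u).card ∧ (A.filter fun u => ∃ t ∈ (insert z T), ω ∈ openConn t u).card ≤ j} =
        (prodBernoulli (Function.update w s(y, z) 0)).real {ω : BondConfig (Fin n) | (∀ t ∈ (insert z T), ω ∉ openConn v t) ∧ 1 ≤ (A.filter fun u => ∃ t ∈ (insert z T), ω ∈ openConn t u).card ∧ (A.filter fun u => ∃ t ∈ (insert z T), ω ∈ openConn t u).card ≤ j} ∧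
      (prodBernoulli (Function.update w s(y, z) 1)).real {ω : BondConfig (Fin n) | (A.filter fun u => ∃ t ∈ (insert z T), ω ∈ openConn t u).card = 0 ∧ (A.filter fun u => ω ∈ openConn a u).card ≤ j} =
        (prodBernoulli (Function.update w s(y, z) 0)).real {ω : BondConfig (Fin n) | (A.filter fun u => ∃ t ∈ (insert z T), ω ∈ openConn t u).card = 0 ∧ (A.filter fun u => ω ∈ openConn a u).card ≤ j} ∧
      (prodBernoulli (Function.update w s(y, z) 1)).real {ω : BondConfig (Fin n) | (∃ t ∈ (insert z T), ω ∈ openConn v t) ∧ (A.filter fun u => ∃ t ∈ (insert z T), ω ∈ openConn t u).card ≤ j} =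
        (prodBernoulli (Function.update w s(y, z) 0)).real {ω : BondConfig (Fin n) | (∃ t ∈ (insert z T), ω ∈ openConn v t) ∧ (A.filter fun u => ∃ t ∈ (insert z T), ω ∈ openConn t u).card ≤ j} := by
  have hy' : y ∈ insert z T := Finset.mem_insert_of_mem hy
  have hins : insert z (insert z T) = insert z T := Finset.insert_idem z T
  refine ⟨?_, ?_, ?_, ?_⟩
  · rw [tieLiftOne_real_one_eq, preimage_insert_E1 hyz (insert z T) A hy' v j, hins]
  · rw [tieLiftOne_real_one_eq, preimage_insert_E2 hyz (insert z T) A hy' v j, hins]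
  · rw [tieLiftOne_real_one_eq, preimage_insert_E3 hyz (insert z T) A hy' ha j, hins]
  · rw [tieLiftOne_real_one_eq, preimage_insert_Q hyz (insert z T) A hy' v j, hins]

end PivotCertificate

open PivotCertificate GreedyComparator ChampionStability

/-! ### Soundness of pivot certificates -/

/-- **Soundness of pivot certificates.**  If every root `(w, x, a₀)` (free observer `x`, champion `a₀`) has a pivot certificate — `Good(w,{x},a₀,0)`
for every predicate `Good` closed under the five certificate rules (module docstring) — then `A_w({x};a₀,a₀) ≥ 0` (CST@champion at `x`).
Proof: `Good(w',T',d,β) := β ≤ A_{w'}(T';d,a₀)` is closed under the rules (`base_ge`, `relay_leaf_nonneg`, the one-bond decomposition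
`stub_oneBondDecomp_k15` / with absorption `real_eq_oneBond_shift` + `preimage_insert_*`, the switch identity `real_E2_eq`, and
`real_update_one_eq_zero_of_absorbed` for the convention `c = 1`). -/
theorem cst_of_pivotCertificate
    (hCert : ∀ (n : ℕ) (w : Sym2 (Fin n) → unitInterval) (A : Finset (Fin n)) (j : ℕ) (x a₀ : Fin n),
      x ∉ A → a₀ ∈ A →
      (∀ b ∈ A, (prodBernoulli w).real {ω : BondConfig (Fin n) | (A.filter fun u => ω ∈ openConn b u).card ≤ j} ≤ (prodBernoulli w).real {ω : BondConfig (Fin n) | (A.filter fun u => ω ∈ openConn a₀ u).card ≤ j}) →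
      ∀ Good : (Sym2 (Fin n) → unitInterval) → Finset (Fin n) → Fin n → ℝ → Prop,
        (∀ (w' : Sym2 (Fin n) → unitInterval) (T' : Finset (Fin n)) (d : Fin n) (β β' : ℝ),
          Good w' T' d β → β' ≤ β → Good w' T' d β') →
        (∀ (w' : Sym2 (Fin n) → unitInterval) (T' : Finset (Fin n)) (d : Fin n), Disjoint T' A → d ∈ A →
          (∀ y ∈ T', ∀ z : Fin n, z ∉ T' → w' s(y, z) = 0) →
          Good w' T' d ((prodBernoulli w').real {ω : BondConfig (Fin n) | (A.filter fun u => ω ∈ openConn d u).card ≤ j} - (prodBernoulli w').real {ω : BondConfig (Fin n) | (A.filter fun u => ω ∈ openConn a₀ u).card ≤ j})) →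
        (∀ (w' : Sym2 (Fin n) → unitInterval) (T' : Finset (Fin n)) (d r : Fin n), r ∈ T' → r ∈ A →
          (prodBernoulli w').real {ω : BondConfig (Fin n) | (A.filter fun u => ω ∈ openConn r u).card ≤ j} ≤ (prodBernoulli w').real {ω : BondConfig (Fin n) | (A.filter fun u => ω ∈ openConn d u).card ≤ j} →
          Good w' T' d 0) →
        (∀ (w' : Sym2 (Fin n) → unitInterval) (T' : Finset (Fin n)) (d d₀ d₁ : Fin n) (e : Sym2 (Fin n)) (β₀ β₁ : ℝ),
          d ∈ A → d₀ ∈ A → d₁ ∈ A →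
          Good (Function.update w' e 0) T' d₀ β₀ → Good (Function.update w' e 1) T' d₁ β₁ →
          Good w' T' d ((1 - (w' e : ℝ)) * β₀ + (w' e : ℝ) * β₁ +
            (1 - (w' e : ℝ)) * (((prodBernoulli (Function.update w' e 0)).real {ω : BondConfig (Fin n) | (∀ t ∈ T', ω ∉ openConn d t) ∧ (A.filter fun u => ω ∈ openConn d u).card ≤ j} + (prodBernoulli (Function.update w' e 0)).real {ω : BondConfig (Fin n) | (∃ t ∈ T', ω ∈ openConn d t) ∧ (A.filter fun u => ∃ t ∈ T', ω ∈ openConn t u).card ≤ j}) - ((prodBernoulli (Function.update w' e 0)).real {ω : BondConfig (Fin n) | (∀ t ∈ T', ω ∉ openConn d₀ t) ∧ (A.filter fun u => ω ∈ openConn d₀ u).card ≤ j} + (prodBernoulli (Function.update w' e 0)).real {ω : BondConfig (Fin n) | (∃ t ∈ T', ω ∈ openConn d₀ t) ∧ (A.filter fun u => ∃ t ∈ T', ω ∈ openConn t u).card ≤ j})) +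
            (w' e : ℝ) * (((prodBernoulli (Function.update w' e 1)).real {ω : BondConfig (Fin n) | (∀ t ∈ T', ω ∉ openConn d t) ∧ (A.filter fun u => ω ∈ openConn d u).card ≤ j} + (prodBernoulli (Function.update w' e 1)).real {ω : BondConfig (Fin n) | (∃ t ∈ T', ω ∈ openConn d t) ∧ (A.filter fun u => ∃ t ∈ T', ω ∈ openConn t u).card ≤ j}) - ((prodBernoulli (Function.update w' e 1)).real {ω : BondConfig (Fin n) | (∀ t ∈ T', ω ∉ openConn d₁ t) ∧ (A.filter fun u => ω ∈ openConn d₁ u).card ≤ j} + (prodBernoulli (Function.update w' e 1)).real {ω : BondConfig (Fin n) | (∃ t ∈ T', ω ∈ openConn d₁ t) ∧ (A.filter fun u => ∃ t ∈ T', ω ∈ openConn t u).card ≤ j})))) →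
        (∀ (w' : Sym2 (Fin n) → unitInterval) (T' : Finset (Fin n)) (d d₀ d₁ y z : Fin n) (c : unitInterval) (β₀ β₁ : ℝ),
          d ∈ A → d₀ ∈ A → d₁ ∈ A → y ∈ T' → z ∉ T' → (c = 0 ∨ c = 1) →
          Good (Function.update w' s(y, z) 0) T' d₀ β₀ → Good (Function.update w' s(y, z) c) (insert z T') d₁ β₁ →
          Good w' T' d ((1 - (w' s(y, z) : ℝ)) * β₀ + (w' s(y, z) : ℝ) * β₁ +
            (1 - (w' s(y, z) : ℝ)) * (((prodBernoulli (Function.update w' s(y, z) 0)).real {ω : BondConfig (Fin n) | (∀ t ∈ T', ω ∉ openConn d t) ∧ (A.filter fun u => ω ∈ openConn d u).card ≤ j} + (prodBernoulli (Function.update w' s(y, z) 0)).real {ω : BondConfig (Fin n) | (∃ t ∈ T', ω ∈ openConn d t) ∧ (A.filter fun u => ∃ t ∈ T', ω ∈ openConn t u).card ≤ j}) - ((prodBernoulli (Function.update w' s(y, z) 0)).real {ω : BondConfig (Fin n) | (∀ t ∈ T', ω ∉ openConn d₀ t) ∧ (A.filter fun u => ω ∈ openConn d₀ u).card ≤ j}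 + (prodBernoulli (Function.update w' s(y, z) 0)).real {ω : BondConfig (Fin n) | (∃ t ∈ T', ω ∈ openConn d₀ t) ∧ (A.filter fun u => ∃ t ∈ T', ω ∈ openConn t u).card ≤ j})) +
            (w' s(y, z) : ℝ) * (((prodBernoulli (Function.update w' s(y, z) c)).real {ω : BondConfig (Fin n) | (∀ t ∈ (insert z T'), ω ∉ openConn d t) ∧ (A.filter fun u => ω ∈ openConn d u).card ≤ j} + (prodBernoulli (Function.update w' s(y, z) c)).real {ω : BondConfig (Fin n) | (∃ t ∈ (insert z T'), ω ∈ openConn d t) ∧ (A.filter fun u => ∃ t ∈ (insert z T'), ω ∈ openConn t u).card ≤ j}) - ((prodBernoulli (Function.update w' s(y, z) c)).real {ω : BondConfig (Fin n) | (∀ t ∈ (insert z T'), ω ∉ openConn d₁ t) ∧ (A.filter fun u => ω ∈ openConn d₁ u).card ≤ j} + (prodBernoulli (Function.update w' s(y, z) c)).real {ω : BondConfig (Fin n) | (∃ t ∈ (insert z T'), ω ∈ openConn d₁ t) ∧ (A.filter fun u => ∃ t ∈ (insert z T'), ω ∈ openConn t u).card ≤ j})))) →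
        Good w {x} a₀ 0) :
    ∀ (n : ℕ) (w : Sym2 (Fin n) → unitInterval) (A : Finset (Fin n)) (j : ℕ) (x a₀ : Fin n),
      x ∉ A → a₀ ∈ A →
      (∀ b ∈ A, (prodBernoulli w).real {ω : BondConfig (Fin n) | (A.filter fun u => ω ∈ openConn b u).card ≤ j} ≤
        (prodBernoulli w).real {ω : BondConfig (Fin n) | (A.filter fun u => ω ∈ openConn a₀ u).card ≤ j}) →
      0 ≤ ((prodBernoulli w).real {ω : BondConfig (Fin n) | (∀ t ∈ ({x} : Finset (Fin n)), ω ∉ openConn a₀ t) ∧ (A.filter fun u => ω ∈ openConn a₀ u).card ≤ j} -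
          (prodBernoulli w).real {ω : BondConfig (Fin n) | (∀ t ∈ ({x} : Finset (Fin n)), ω ∉ openConn a₀ t) ∧ 1 ≤ (A.filter fun u => ∃ t ∈ ({x} : Finset (Fin n)), ω ∈ openConn t u).card ∧ (A.filter fun u => ∃ t ∈ ({x} : Finset (Fin n)), ω ∈ openConn t u).card ≤ j} -
          (prodBernoulli w).real {ω : BondConfig (Fin n) | (A.filter fun u => ∃ t ∈ ({x} : Finset (Fin n)), ω ∈ openConn t u).card = 0 ∧ (A.filter fun u => ω ∈ openConn a₀ u).card ≤ j}) := by
  intro n w A j x a₀ hx ha₀ hch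
  have key := hCert n w A j x a₀ hx ha₀ hch
    (fun w' T' d β => β ≤ ((prodBernoulli w').real {ω : BondConfig (Fin n) | (∀ t ∈ T', ω ∉ openConn d t) ∧ (A.filter fun u => ω ∈ openConn d u).card ≤ j} -
          (prodBernoulli w').real {ω : BondConfig (Fin n) | (∀ t ∈ T', ω ∉ openConn d t) ∧ 1 ≤ (A.filter fun u => ∃ t ∈ T', ω ∈ openConn t u).card ∧ (A.filter fun u => ∃ t ∈ T', ω ∈ openConn t u).card ≤ j} -
          (prodBernoulli w').real {ω : BondConfig (Fin n) | (A.filter fun u => ∃ t ∈ T', ω ∈ openConn t u).card = 0 ∧ (A.filter fun u => ω ∈ openConn a₀ u).card ≤ j}))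
  refine key ?_ ?_ ?_ ?_ ?_
  · -- (mono)
    intro w' T' d β β' h hle
    exact hle.trans h
  · -- (base)
    intro w' T' d hT'A hd hbd
    refine base_ge w' T' A hT'A hd j fun y hy z hz => ?_
    rw [hbd y hy z hz]
    rfl
  · -- (relay leaf)
    intro w' T' d r hrT hrA hle
    exact relay_leaf_nonneg w' T' A hrT hrA j hle
  · -- (pivot on an arbitrary pair)
    intro w' T' d d₀ d₁ e β₀ β₁ hd hd₀ hd₁ h0 h1
    have ob1 := stub_oneBondDecomp_k15 n w' e {ω : BondConfig (Fin n) | (∀ t ∈ T', ω ∉ openConn d t) ∧ (A.filter fun u => ω ∈ openConn d u).card ≤ j}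
    have ob2 := stub_oneBondDecomp_k15 n w' e {ω : BondConfig (Fin n) | (∀ t ∈ T', ω ∉ openConn d t) ∧ 1 ≤ (A.filter fun u => ∃ t ∈ T', ω ∈ openConn t u).card ∧ (A.filter fun u => ∃ t ∈ T', ω ∈ openConn t u).card ≤ j}
    have ob3 := stub_oneBondDecomp_k15 n w' e {ω : BondConfig (Fin n) | (A.filter fun u => ∃ t ∈ T', ω ∈ openConn t u).card = 0 ∧ (A.filter fun u => ω ∈ openConn a₀ u).card ≤ j}
    have sw0 := real_E2_eq (prodBernoulli (Function.update w' e 0)) T' A hd j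
    have sw1 := real_E2_eq (prodBernoulli (Function.update w' e 1)) T' A hd j
    have sw2 := real_E2_eq (prodBernoulli (Function.update w' e 0)) T' A hd₀ j
    have sw3 := real_E2_eq (prodBernoulli (Function.update w' e 1)) T' A hd₁ j
    have hp0 : 0 ≤ (w' e : ℝ) := (w' e).2.1
    have hp1 : (w' e : ℝ) ≤ 1 := (w' e).2.2
    rw [ob1, ob2, ob3, sw0, sw1]
    rw [sw2] at h0
    rw [sw3] at h1
    have e0 := mul_le_mul_of_nonneg_left h0 (sub_nonneg.2 hp1)
    have e1 := mul_le_mul_of_nonneg_left h1 hp0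
    nlinarith [e0, e1]
  · -- (absorbing pivot)
    intro w' T' d d₀ d₁ y z c β₀ β₁ hd hd₀ hd₁ hy hz hc h0 h1
    have hyz : y ≠ z := fun h => hz (h ▸ hy)
    have ob1 := real_eq_oneBond_shift w' s(y, z) _ _ (preimage_insert_E1 hyz T' A hy d j)
    have ob2 := real_eq_oneBond_shift w' s(y, z) _ _ (preimage_insert_E2 hyz T' A hy d j)
    have ob3 := real_eq_oneBond_shift w' s(y, z) _ _ (preimage_insert_E3 hyz T' A hy ha₀ j)
    have sw0 := real_E2_eq (prodBernoulli (Function.update w' s(y, z) 0)) T' A hd j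
    have sw1 := real_E2_eq (prodBernoulli (Function.update w' s(y, z) 0)) (insert z T') A hd j
    have sw2 := real_E2_eq (prodBernoulli (Function.update w' s(y, z) 0)) T' A hd₀ j
    have hp0 : 0 ≤ (w' s(y, z) : ℝ) := (w' s(y, z)).2.1
    have hp1 : (w' s(y, z) : ℝ) ≤ 1 := (w' s(y, z)).2.2
    -- read the `c`-child in the convention `c = 0`
    have hc' : (prodBernoulli (Function.update w' s(y, z) c)).real {ω : BondConfig (Fin n) | (∀ t ∈ (insert z T'), ω ∉ openConn d₁ t) ∧ (A.filter fun u => ω ∈ openConn d₁ u).card ≤ j} =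
          (prodBernoulli (Function.update w' s(y, z) 0)).real {ω : BondConfig (Fin n) | (∀ t ∈ (insert z T'), ω ∉ openConn d₁ t) ∧ (A.filter fun u => ω ∈ openConn d₁ u).card ≤ j} ∧
        (prodBernoulli (Function.update w' s(y, z) c)).real {ω : BondConfig (Fin n) | (∀ t ∈ (insert z T'), ω ∉ openConn d₁ t) ∧ 1 ≤ (A.filter fun u => ∃ t ∈ (insert z T'), ω ∈ openConn t u).card ∧ (A.filter fun u => ∃ t ∈ (insert z T'), ω ∈ openConn t u).card ≤ j} =
          (prodBernoulli (Function.update w' s(y, z) 0)).real {ω : BondConfig (Fin n) | (∀ t ∈ (insert z T'), ω ∉ openConn d₁ t) ∧ 1 ≤ (A.filter fun u => ∃ t ∈ (insert z T'), ω ∈ openConn t u).card ∧ (A.filter fun u => ∃ t ∈ (insert z T'), ω ∈ openConn t u).card ≤ j} ∧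
        (prodBernoulli (Function.update w' s(y, z) c)).real {ω : BondConfig (Fin n) | (A.filter fun u => ∃ t ∈ (insert z T'), ω ∈ openConn t u).card = 0 ∧ (A.filter fun u => ω ∈ openConn a₀ u).card ≤ j} =
          (prodBernoulli (Function.update w' s(y, z) 0)).real {ω : BondConfig (Fin n) | (A.filter fun u => ∃ t ∈ (insert z T'), ω ∈ openConn t u).card = 0 ∧ (A.filter fun u => ω ∈ openConn a₀ u).card ≤ j} ∧
        (prodBernoulli (Function.update w' s(y, z) c)).real {ω : BondConfig (Fin n) | (∃ t ∈ (insert z T'), ω ∈ openConn d₁ t) ∧ (A.filter fun u => ∃ t ∈ (insert z T'), ω ∈ openConn t u).card ≤ j} =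
          (prodBernoulli (Function.update w' s(y, z) 0)).real {ω : BondConfig (Fin n) | (∃ t ∈ (insert z T'), ω ∈ openConn d₁ t) ∧ (A.filter fun u => ∃ t ∈ (insert z T'), ω ∈ openConn t u).card ≤ j} ∧
        (prodBernoulli (Function.update w' s(y, z) c)).real {ω : BondConfig (Fin n) | (∀ t ∈ (insert z T'), ω ∉ openConn d t) ∧ (A.filter fun u => ω ∈ openConn d u).card ≤ j} =
          (prodBernoulli (Function.update w' s(y, z) 0)).real {ω : BondConfig (Fin n) | (∀ t ∈ (insert z T'), ω ∉ openConn d t) ∧ (A.filter fun u => ω ∈ openConn d u).card ≤ j} ∧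
        (prodBernoulli (Function.update w' s(y, z) c)).real {ω : BondConfig (Fin n) | (∃ t ∈ (insert z T'), ω ∈ openConn d t) ∧ (A.filter fun u => ∃ t ∈ (insert z T'), ω ∈ openConn t u).card ≤ j} =
          (prodBernoulli (Function.update w' s(y, z) 0)).real {ω : BondConfig (Fin n) | (∃ t ∈ (insert z T'), ω ∈ openConn d t) ∧ (A.filter fun u => ∃ t ∈ (insert z T'), ω ∈ openConn t u).card ≤ j} := by
      rcases hc with rfl | rfl
      · exact ⟨rfl, rfl, rfl, rfl, rfl, rfl⟩
      · obtain ⟨a1, a2, a3, a4⟩ := real_update_one_eq_zero_of_absorbed w' T' A hyz hy d₁ a₀ ha₀ j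
        obtain ⟨b1, -, -, b4⟩ := real_update_one_eq_zero_of_absorbed w' T' A hyz hy d a₀ ha₀ j
        exact ⟨a1, a2, a3, a4, b1, b4⟩
    obtain ⟨c1, c2, c3, c4, c5, c6⟩ := hc'
    rw [c5, c6]
    rw [c1, c2, c3] at h1
    have sw3 := real_E2_eq (prodBernoulli (Function.update w' s(y, z) 0)) (insert z T') A hd₁ j
    rw [ob1, ob2, ob3, sw0, sw1]
    rw [sw2] at h0
    rw [sw3] at h1
    have e0 := mul_le_mul_of_nonneg_left h0 (sub_nonneg.2 hp1)
    have e1 := mul_le_mul_of_nonneg_left h1 hp0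
    nlinarith [e0, e1, c4]

/-- **Pivot certificates close the cumulative isolation lemma** (`stub_cumulativeIsolation` verbatim): at every free observer the champion is a
valid witness, by `cst_of_pivotCertificate` and the bookkeeping `μ{1 ≤ N ≤ j} ≤ μE₂({o},i) + (I(i) − μE₁({o},i))`. -/
theorem cumulativeIsolation_of_pivotCertificate
    (hCert : ∀ (n : ℕ) (w : Sym2 (Fin n) → unitInterval) (A : Finset (Fin n)) (j : ℕ) (x a₀ : Fin n),
      x ∉ A → a₀ ∈ A →
      (∀ b ∈ A, (prodBernoulli w).real {ω : BondConfig (Fin n) | (A.filter fun u => ω ∈ openConn b u).card ≤ j} ≤ (prodBernoulli w).real {ω : BondConfig (Fin n) | (A.filter fun u => ω ∈ openConn a₀ u).card ≤ j}) →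
      ∀ Good : (Sym2 (Fin n) → unitInterval) → Finset (Fin n) → Fin n → ℝ → Prop,
        (∀ (w' : Sym2 (Fin n) → unitInterval) (T' : Finset (Fin n)) (d : Fin n) (β β' : ℝ),
          Good w' T' d β → β' ≤ β → Good w' T' d β') →
        (∀ (w' : Sym2 (Fin n) → unitInterval) (T' : Finset (Fin n)) (d : Fin n), Disjoint T' A → d ∈ A →
          (∀ y ∈ T', ∀ z : Fin n, z ∉ T' → w' s(y, z) = 0) →
          Good w' T' d ((prodBernoulli w').real {ω : BondConfig (Fin n) | (A.filter fun u => ω ∈ openConn d u).card ≤ j} - (prodBernoulli w').real {ω : BondConfig (Fin n) | (A.filter fun u => ω ∈ openConn a₀ u).card ≤ j})) →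
        (∀ (w' : Sym2 (Fin n) → unitInterval) (T' : Finset (Fin n)) (d r : Fin n), r ∈ T' → r ∈ A →
          (prodBernoulli w').real {ω : BondConfig (Fin n) | (A.filter fun u => ω ∈ openConn r u).card ≤ j} ≤ (prodBernoulli w').real {ω : BondConfig (Fin n) | (A.filter fun u => ω ∈ openConn d u).card ≤ j} →
          Good w' T' d 0) →
        (∀ (w' : Sym2 (Fin n) → unitInterval) (T' : Finset (Fin n)) (d d₀ d₁ : Fin n) (e : Sym2 (Fin n)) (β₀ β₁ : ℝ),
          d ∈ A → d₀ ∈ A → d₁ ∈ A →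
          Good (Function.update w' e 0) T' d₀ β₀ → Good (Function.update w' e 1) T' d₁ β₁ →
          Good w' T' d ((1 - (w' e : ℝ)) * β₀ + (w' e : ℝ) * β₁ +
            (1 - (w' e : ℝ)) * (((prodBernoulli (Function.update w' e 0)).real {ω : BondConfig (Fin n) | (∀ t ∈ T', ω ∉ openConn d t) ∧ (A.filter fun u => ω ∈ openConn d u).card ≤ j} + (prodBernoulli (Function.update w' e 0)).real {ω : BondConfig (Fin n) | (∃ t ∈ T', ω ∈ openConn d t) ∧ (A.filter fun u => ∃ t ∈ T', ω ∈ openConn t u).card ≤ j}) - ((prodBernoulli (Function.update w' e 0)).real {ω : BondConfig (Fin n) | (∀ t ∈ T', ω ∉ openConn d₀ t) ∧ (A.filter fun u => ω ∈ openConn d₀ u).card ≤ j} + (prodBernoulli (Function.update w' e 0)).real {ω : BondConfig (Fin n) | (∃ t ∈ T', ω ∈ openConn d₀ t) ∧ (A.filter fun u => ∃ t ∈ T', ω ∈ openConn t u).card ≤ j})) +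
            (w' e : ℝ) * (((prodBernoulli (Function.update w' e 1)).real {ω : BondConfig (Fin n) | (∀ t ∈ T', ω ∉ openConn d t) ∧ (A.filter fun u => ω ∈ openConn d u).card ≤ j} + (prodBernoulli (Function.update w' e 1)).real {ω : BondConfig (Fin n) | (∃ t ∈ T', ω ∈ openConn d t) ∧ (A.filter fun u => ∃ t ∈ T', ω ∈ openConn t u).card ≤ j}) - ((prodBernoulli (Function.update w' e 1)).real {ω : BondConfig (Fin n) | (∀ t ∈ T', ω ∉ openConn d₁ t) ∧ (A.filter fun u => ω ∈ openConn d₁ u).card ≤ j} + (prodBernoulli (Function.update w' e 1)).real {ω : BondConfig (Fin n) | (∃ t ∈ T', ω ∈ openConn d₁ t) ∧ (A.filter fun u => ∃ t ∈ T', ω ∈ openConn t u).card ≤ j})))) →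
        (∀ (w' : Sym2 (Fin n) → unitInterval) (T' : Finset (Fin n)) (d d₀ d₁ y z : Fin n) (c : unitInterval) (β₀ β₁ : ℝ),
          d ∈ A → d₀ ∈ A → d₁ ∈ A → y ∈ T' → z ∉ T' → (c = 0 ∨ c = 1) →
          Good (Function.update w' s(y, z) 0) T' d₀ β₀ → Good (Function.update w' s(y, z) c) (insert z T') d₁ β₁ →
          Good w' T' d ((1 - (w' s(y, z) : ℝ)) * β₀ + (w' s(y, z) : ℝ) * β₁ +
            (1 - (w' s(y, z) : ℝ)) * (((prodBernoulli (Function.update w' s(y, z) 0)).real {ω : BondConfig (Fin n) | (∀ t ∈ T', ω ∉ openConn d t) ∧ (A.filter fun u => ω ∈ openConn d u).card ≤ j} + (prodBernoulli (Function.update w' s(y, z) 0)).real {ω : BondConfig (Fin n) | (∃ t ∈ T', ω ∈ openConn d t) ∧ (A.filter fun u => ∃ t ∈ T', ω ∈ openConn t u).card ≤ j}) - ((prodBernoulli (Function.update w' s(y, z) 0)).real {ω : BondConfig (Fin n) | (∀ t ∈ T', ω ∉ openConn d₀ t) ∧ (A.filter fun u => ω ∈ openConn d₀ u).card ≤ j}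 + (prodBernoulli (Function.update w' s(y, z) 0)).real {ω : BondConfig (Fin n) | (∃ t ∈ T', ω ∈ openConn d₀ t) ∧ (A.filter fun u => ∃ t ∈ T', ω ∈ openConn t u).card ≤ j})) +
            (w' s(y, z) : ℝ) * (((prodBernoulli (Function.update w' s(y, z) c)).real {ω : BondConfig (Fin n) | (∀ t ∈ (insert z T'), ω ∉ openConn d t) ∧ (A.filter fun u => ω ∈ openConn d u).card ≤ j} + (prodBernoulli (Function.update w' s(y, z) c)).real {ω : BondConfig (Fin n) | (∃ t ∈ (insert z T'), ω ∈ openConn d t) ∧ (A.filter fun u => ∃ t ∈ (insert z T'), ω ∈ openConn t u).card ≤ j}) - ((prodBernoulli (Function.update w' s(y, z) c)).real {ω : BondConfig (Fin n) | (∀ t ∈ (insert z T'), ω ∉ openConn d₁ t) ∧ (A.filter fun u => ω ∈ openConn d₁ u).card ≤ j} + (prodBernoulli (Function.update w' s(y, z) c)).real {ω : BondConfig (Fin n) | (∃ t ∈ (insert z T'), ω ∈ openConn d₁ t) ∧ (A.filter fun u => ∃ t ∈ (insert z T'), ω ∈ openConn t u).card ≤ j})))) →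
        Good w {x} a₀ 0) :
    ∀ (n : ℕ) (w : Sym2 (Fin n) → unitInterval) (A : Finset (Fin n)) (o : Fin n) (j : ℕ),
      A.Nonempty → o ∉ A → ∃ a ∈ A,
        (Literature.Probability.LatticeModels.prodBernoulli w).real
            {ω : Literature.Probability.Percolation.BondConfig (Fin n) |
              1 ≤ (A.filter fun x => ω ∈ Literature.Probability.Percolation.openConn o x).card ∧
                (A.filter fun x => ω ∈ Literature.Probability.Percolation.openConn o x).card ≤ j} ≤
          (Literature.Probability.LatticeModels.prodBernoulli w).real
            {ω : Literature.Probability.Percolation.BondConfig (Fin n) |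
              (A.filter fun x => ω ∈ Literature.Probability.Percolation.openConn a x).card ≤ j} := by
  intro n w A o j hA ho
  obtain ⟨i, hi, hch⟩ := MergeStability.exists_champion (prodBernoulli w) A hA j
  refine ⟨i, hi, ?_⟩
  have key := cst_of_pivotCertificate hCert n w A j o i ho hi hch
  have hmeas : ∀ S : Set (BondConfig (Fin n)), MeasurableSet S := fun S => (Set.toFinite S).measurableSet
  have hpi : ∀ ω : BondConfig (Fin n), (A.filter fun x => ∃ t ∈ ({o} : Finset (Fin n)), ω ∈ openConn t x) =
      (A.filter fun x => ω ∈ openConn o x) := by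
    intro ω
    apply Finset.filter_congr
    intro x _
    simp only [Finset.mem_singleton, exists_eq_left]
  have hsplit : (prodBernoulli w).real {ω : BondConfig (Fin n) | 1 ≤ (A.filter fun x => ω ∈ openConn o x).card ∧
      (A.filter fun x => ω ∈ openConn o x).card ≤ j} ≤
      (prodBernoulli w).real {ω : BondConfig (Fin n) | (∀ t ∈ ({o} : Finset (Fin n)), ω ∉ openConn i t) ∧ 1 ≤ (A.filter fun u => ∃ t ∈ ({o} : Finset (Fin n)), ω ∈ openConn t u).card ∧ (A.filter fun u => ∃ t ∈ ({o} : Finset (Fin n)), ω ∈ openConn t u).card ≤ j} +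
        (prodBernoulli w).real ({ω : BondConfig (Fin n) | (A.filter fun u => ω ∈ openConn i u).card ≤ j} \
          {ω : BondConfig (Fin n) | (∀ t ∈ ({o} : Finset (Fin n)), ω ∉ openConn i t) ∧ (A.filter fun u => ω ∈ openConn i u).card ≤ j}) := by
    calc (prodBernoulli w).real {ω : BondConfig (Fin n) | 1 ≤ (A.filter fun x => ω ∈ openConn o x).card ∧
          (A.filter fun x => ω ∈ openConn o x).card ≤ j}
        ≤ (prodBernoulli w).real ({ω : BondConfig (Fin n) | (∀ t ∈ ({o} : Finset (Fin n)), ω ∉ openConn i t) ∧ 1 ≤ (A.filter fun u => ∃ t ∈ ({o} : Finset (Fin n)), ω ∈ openConn t u).card ∧ (A.filter fun u => ∃ t ∈ ({o} : Finset (Fin n)), ω ∈ openConn t u).card ≤ j} ∪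
            ({ω : BondConfig (Fin n) | (A.filter fun u => ω ∈ openConn i u).card ≤ j} \
              {ω : BondConfig (Fin n) | (∀ t ∈ ({o} : Finset (Fin n)), ω ∉ openConn i t) ∧ (A.filter fun u => ω ∈ openConn i u).card ≤ j})) := by
          refine measureReal_mono (fun ω hω => ?_) (measure_ne_top _ _)
          obtain ⟨h1, h2⟩ := hω
          by_cases hc : ω ∈ openConn i o
          · right
            refine ⟨?_, fun h => h.1 o (Finset.mem_singleton_self o) hc⟩
            have heq : (A.filter fun x => ω ∈ openConn i x) = (A.filter fun x => ω ∈ openConn o x) := by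
              apply Finset.filter_congr
              intro x _
              simp only [mem_openConn_iff_reachable] at hc ⊢
              exact ⟨fun h => hc.symm.trans h, fun h => hc.trans h⟩
            show (A.filter fun x => ω ∈ openConn i x).card ≤ j
            rw [heq]; exact h2
          · left
            refine ⟨fun t ht => ?_, ?_, ?_⟩
            · rw [Finset.mem_singleton.1 ht]; exact hc
            · rw [hpi ω]; exact h1
            · rw [hpi ω]; exact h2
      _ ≤ _ := measureReal_union_le _ _
  have hdiff : (prodBernoulli w).real ({ω : BondConfig (Fin n) | (A.filter fun u => ω ∈ openConn i u).card ≤ j} \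
          {ω : BondConfig (Fin n) | (∀ t ∈ ({o} : Finset (Fin n)), ω ∉ openConn i t) ∧ (A.filter fun u => ω ∈ openConn i u).card ≤ j}) =
      (prodBernoulli w).real {ω : BondConfig (Fin n) | (A.filter fun u => ω ∈ openConn i u).card ≤ j} -
        (prodBernoulli w).real {ω : BondConfig (Fin n) | (∀ t ∈ ({o} : Finset (Fin n)), ω ∉ openConn i t) ∧ (A.filter fun u => ω ∈ openConn i u).card ≤ j} :=
    measureReal_sdiff (fun ω hω => hω.2) (hmeas _)
  have hE3 : 0 ≤ (prodBernoulli w).real {ω : BondConfig (Fin n) | (A.filter fun u => ∃ t ∈ ({o} : Finset (Fin n)), ω ∈ openConn t u).card = 0 ∧ (A.filter fun u => ω ∈ openConn i u).card ≤ j} := measureReal_nonneg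
  linarith

/-- **Pivot certificates close the crux**: `hCert → NoHeavyLowerTail`, through `cumulativeIsolation_of_pivotCertificate` and the landed
`noHeavyLowerTail_of_stub_cumulativeIsolation`. -/
theorem noHeavyLowerTail_of_pivotCertificate
    (hCert : ∀ (n : ℕ) (w : Sym2 (Fin n) → unitInterval) (A : Finset (Fin n)) (j : ℕ) (x a₀ : Fin n),
      x ∉ A → a₀ ∈ A →
      (∀ b ∈ A, (prodBernoulli w).real {ω : BondConfig (Fin n) | (A.filter fun u => ω ∈ openConn b u).card ≤ j} ≤ (prodBernoulli w).real {ω : BondConfig (Fin n) | (A.filter fun u => ω ∈ openConn a₀ u).card ≤ j}) →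
      ∀ Good : (Sym2 (Fin n) → unitInterval) → Finset (Fin n) → Fin n → ℝ → Prop,
        (∀ (w' : Sym2 (Fin n) → unitInterval) (T' : Finset (Fin n)) (d : Fin n) (β β' : ℝ),
          Good w' T' d β → β' ≤ β → Good w' T' d β') →
        (∀ (w' : Sym2 (Fin n) → unitInterval) (T' : Finset (Fin n)) (d : Fin n), Disjoint T' A → d ∈ A →
          (∀ y ∈ T', ∀ z : Fin n, z ∉ T' → w' s(y, z) = 0) →
          Good w' T' d ((prodBernoulli w').real {ω : BondConfig (Fin n) | (A.filter fun u => ω ∈ openConn d u).card ≤ j} - (prodBernoulli w').real {ω : BondConfig (Fin n) | (A.filter fun u => ω ∈ openConn a₀ u).card ≤ j})) →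
        (∀ (w' : Sym2 (Fin n) → unitInterval) (T' : Finset (Fin n)) (d r : Fin n), r ∈ T' → r ∈ A →
          (prodBernoulli w').real {ω : BondConfig (Fin n) | (A.filter fun u => ω ∈ openConn r u).card ≤ j} ≤ (prodBernoulli w').real {ω : BondConfig (Fin n) | (A.filter fun u => ω ∈ openConn d u).card ≤ j} →
          Good w' T' d 0) →
        (∀ (w' : Sym2 (Fin n) → unitInterval) (T' : Finset (Fin n)) (d d₀ d₁ : Fin n) (e : Sym2 (Fin n)) (β₀ β₁ : ℝ),
          d ∈ A → d₀ ∈ A → d₁ ∈ A →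
          Good (Function.update w' e 0) T' d₀ β₀ → Good (Function.update w' e 1) T' d₁ β₁ →
          Good w' T' d ((1 - (w' e : ℝ)) * β₀ + (w' e : ℝ) * β₁ +
            (1 - (w' e : ℝ)) * (((prodBernoulli (Function.update w' e 0)).real {ω : BondConfig (Fin n) | (∀ t ∈ T', ω ∉ openConn d t) ∧ (A.filter fun u => ω ∈ openConn d u).card ≤ j} + (prodBernoulli (Function.update w' e 0)).real {ω : BondConfig (Fin n) | (∃ t ∈ T', ω ∈ openConn d t) ∧ (A.filter fun u => ∃ t ∈ T', ω ∈ openConn t u).card ≤ j}) - ((prodBernoulli (Function.update w' e 0)).real {ω : BondConfig (Fin n) | (∀ t ∈ T', ω ∉ openConn d₀ t) ∧ (A.filter fun u => ω ∈ openConn d₀ u).card ≤ j} + (prodBernoulli (Function.update w' e 0)).real {ω : BondConfig (Fin n) | (∃ t ∈ T', ω ∈ openConn d₀ t) ∧ (A.filter fun u => ∃ t ∈ T', ω ∈ openConn t u).card ≤ j})) +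
            (w' e : ℝ) * (((prodBernoulli (Function.update w' e 1)).real {ω : BondConfig (Fin n) | (∀ t ∈ T', ω ∉ openConn d t) ∧ (A.filter fun u => ω ∈ openConn d u).card ≤ j} + (prodBernoulli (Function.update w' e 1)).real {ω : BondConfig (Fin n) | (∃ t ∈ T', ω ∈ openConn d t) ∧ (A.filter fun u => ∃ t ∈ T', ω ∈ openConn t u).card ≤ j}) - ((prodBernoulli (Function.update w' e 1)).real {ω : BondConfig (Fin n) | (∀ t ∈ T', ω ∉ openConn d₁ t) ∧ (A.filter fun u => ω ∈ openConn d₁ u).card ≤ j} + (prodBernoulli (Function.update w' e 1)).real {ω : BondConfig (Fin n) | (∃ t ∈ T', ω ∈ openConn d₁ t) ∧ (A.filter fun u => ∃ t ∈ T', ω ∈ openConn t u).card ≤ j})))) →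
        (∀ (w' : Sym2 (Fin n) → unitInterval) (T' : Finset (Fin n)) (d d₀ d₁ y z : Fin n) (c : unitInterval) (β₀ β₁ : ℝ),
          d ∈ A → d₀ ∈ A → d₁ ∈ A → y ∈ T' → z ∉ T' → (c = 0 ∨ c = 1) →
          Good (Function.update w' s(y, z) 0) T' d₀ β₀ → Good (Function.update w' s(y, z) c) (insert z T') d₁ β₁ →
          Good w' T' d ((1 - (w' s(y, z) : ℝ)) * β₀ + (w' s(y, z) : ℝ) * β₁ +
            (1 - (w' s(y, z) : ℝ)) * (((prodBernoulli (Function.update w' s(y, z) 0)).real {ω : BondConfig (Fin n) | (∀ t ∈ T', ω ∉ openConn d t) ∧ (A.filter fun u => ω ∈ openConn d u).card ≤ j} + (prodBernoulli (Function.update w' s(y, z) 0)).real {ω : BondConfig (Fin n) | (∃ t ∈ T', ω ∈ openConn d t) ∧ (A.filter fun u => ∃ t ∈ T', ω ∈ openConn t u).card ≤ j}) - ((prodBernoulli (Function.update w' s(y, z) 0)).real {ω : BondConfig (Fin n) | (∀ t ∈ T', ω ∉ openConn d₀ t) ∧ (A.filter fun u => ω ∈ openConn d₀ u).card ≤ j}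 + (prodBernoulli (Function.update w' s(y, z) 0)).real {ω : BondConfig (Fin n) | (∃ t ∈ T', ω ∈ openConn d₀ t) ∧ (A.filter fun u => ∃ t ∈ T', ω ∈ openConn t u).card ≤ j})) +
            (w' s(y, z) : ℝ) * (((prodBernoulli (Function.update w' s(y, z) c)).real {ω : BondConfig (Fin n) | (∀ t ∈ (insert z T'), ω ∉ openConn d t) ∧ (A.filter fun u => ω ∈ openConn d u).card ≤ j} + (prodBernoulli (Function.update w' s(y, z) c)).real {ω : BondConfig (Fin n) | (∃ t ∈ (insert z T'), ω ∈ openConn d t) ∧ (A.filter fun u => ∃ t ∈ (insert z T'), ω ∈ openConn t u).card ≤ j}) - ((prodBernoulli (Function.update w' s(y, z) c)).real {ω : BondConfig (Fin n) | (∀ t ∈ (insert z T'), ω ∉ openConn d₁ t) ∧ (A.filter fun u => ω ∈ openConn d₁ u).card ≤ j} + (prodBernoulli (Function.update w' s(y, z) c)).real {ω : BondConfig (Fin n) | (∃ t ∈ (insert z T'), ω ∈ openConn d₁ t) ∧ (A.filter fun u => ∃ t ∈ (insert z T'), ω ∈ openConn t u).card ≤ j})))) →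
        Good w {x} a₀ 0) :
    Summit.CriticalPhenomena.PercolationContinuityZ3.Theses.PercNearOneGluing.NoHeavyLowerTail :=
  noHeavyLowerTail_of_stub_cumulativeIsolation (cumulativeIsolation_of_pivotCertificate hCert)

end Summit.CriticalPhenomena.PercolationContinuityZ3.Theorems

end
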